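import Summits.HodgeConjecture.HodgeCM.Proofs.SeesawConstruction_1

/-! PORT of `HodgeCM/Proofs/SeesawConstruction.lean` (HodgeCMPerL run 82) — part 2: continuation of `Summits.HodgeConjecture.HodgeCM.Proofs.SeesawConstruction_1` (split at a top-level declaration boundary by port_pkg.py; scope re-opened below; declarations unchanged). -/

-- port_pkg: scope re-opened for this part (file-level context, then the namespace/section stack open at the cut)
set_option autoImplicit false
noncomputable section
open scoped TensorProduct InnerProductSpace Matrix
open Filter Topology
open NumberField NumberField.InfinitePlace
namespace HodgeCM
open Literature.AlgebraicGeometry.Motives (CMType HodgeStructure)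
open Literature.AlgebraicGeometry.Motives.HodgeStructure (conj)
open Literature.AlgebraicGeometry.ShimuraVarieties (conjRingHomK embedding_conjRingHomK)
open HodgeCM.Prior.Perl34File
open CMTypeOps
namespace Universe
namespace ThetaModel
variable {U : Universe} (T : U.ThetaModel)
/-- **Def 3.2 + Lemma 3.3(b) ⇒ the seesaw datum, CONSTRUCTED** (PerL v5 tex ll. 269–314): four
conjugation-fixed non-zero `a_i ∈ L` with the forced signs AND an isometry `⟨a₀, a₁⟩ ≅ ⟨a₂, a₃⟩`, with no appeal to
Landherr's classification / Hasse–Minkowski: `a₀ = e₀ t`, `a₁ = e₁`, `a₂ = a₀ + a₁`, `a₃ = a₀a₁a₂⁻¹` with `t`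
totally positive of suitable magnitudes (`exists_totallyPositive_magnitudes`), isometry by
`Lemma33bLandherrProof.isometry_of_rep` with `p = q = z = 1`.  This is `exists_seesawDatum` WITHOUT its hypothesis
`hL : Lemma33bLandherr`. -/
theorem exists_seesawDatum_constructed (hκ : T.Design_kappaConj) (hs : T.Design_frameSignConj)
    {K L : CMField} (j : K →+* L) (ι₁ : L →+* ℂ) (Ψ : Fin 4 → CMType K) (hΨ : PairSum Ψ) :
    ∃ D : StubTree.SeesawDatum L, T.SignsForced K L j ι₁ Ψ D := by
  classical
  -- the required sign is a function of the place (conjugation invariance of `reqPos`)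
  let P : Fin 4 → InfinitePlace L → Bool := fun i w => T.reqPos K L j ι₁ (Ψ i) w.embedding
  have hP : ∀ (i : Fin 4) (τ : L →+* ℂ), T.reqPos K L j ι₁ (Ψ i) τ = P i (InfinitePlace.mk τ) := by
    intro i τ
    have hτ : InfinitePlace.mk τ = InfinitePlace.mk (InfinitePlace.mk τ).embedding := by rw [mk_embedding]
    rcases mk_eq_iff.mp hτ with h | h
    · simp only [P]; rw [← h]
    · simp only [P]; rw [← h, reqPos_conjugate T hκ hs]
  -- Lemma 3.3(b): the pair condition at every place
  have hpair : ∀ w : InfinitePlace L, ({P 0 w, P 1 w} : Multiset Bool) = {P 2 w, P 3 w} :=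
    fun w => (T.reqPos_pairSum j ι₁ Ψ hΨ w.embedding).1
  obtain ⟨D, hD⟩ := exists_seesawDatum_of_signs L P hpair
  refine ⟨D, fun i τ => ?_⟩
  rw [hP]
  exact hD i τ

/-- **The construction of `RealisationConstruction.lean`, from ANY forced-sign seesaw datum** (proof body =
`nonempty_thetaRealisation` of the prl1 seat, verbatim after its first line): the theta realisation data exist. -/
theorem nonempty_thetaRealisation_of_seesaw (M : U.ModelAxioms) (A : T.Inputs) (hHR : U.Fact_hodgeRiemann20)
    (hLD : LevelDirected) {K L : CMField} (j : K →+* L) (ι₁ : L →+* ℂ)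
    (Ψ : Fin 4 → CMType K) (σ : K →+* ℂ) (hσ : ι₁.comp j = σ) (hΨ : PairSum Ψ)
    (hinj : Function.Injective Ψ) (hmem : ∀ i, σ ∈ (Ψ i).1) (V : HermSpace3 L ι₁)
    (D : StubTree.SeesawDatum L) (hD : T.SignsForced K L j ι₁ Ψ D) :
    Nonempty (U.ThetaRealisation ι₁ V K Ψ σ) := by
  let c : SeesawCtx L := ⟨K, Ψ, σ, D⟩
  have hc : T.GoodCtx ι₁ c := ⟨hΨ, hinj, hmem, ⟨j, hσ, hD⟩⟩
  have hH10 : ∀ (i : Fin 4) (Γ : Level V), ∀ ω ∈ T.Theta V c i Γ, ω ∈ U.H10 (U.pms L ι₁ V Γ) :=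
    fun i Γ ω hω => U.Uiso_le_H10 M.pull_hodge Γ K (Ψ i) σ (A.thetaSub V c hc i Γ hω)
  refine ⟨{
    H := T.H V c
    HG := T.HG L ι₁ V
    CG := T.CG V c
    G := T.G V c
    SK := T.SK V c
    SigIdx := T.SigIdx V c
    SigIdxG := T.SigIdxG V c
    S := { core := T.core V c, t12 := T.t12 V c, t34 := T.t34 V c
           H_chars12 := (A.chars V c hc).1, H_chars34 := (A.chars V c hc).2
           H_occ12 := (A.occ V c hc).1, H_occ34 := (A.occ V c hc).2 }
    Λ := fun Γ => T.Λ Γ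
    Theta := fun i Γ => T.Theta V c i Γ
    Theta_sub := fun i Γ => A.thetaSub V c hc i Γ
    lineField := ?_
    gen12 := fun Γ ω₁ ω₂ h₁ h₂ => A.thetaGen12 V c hc Γ ω₁ ω₂ h₁ h₂
    real34 := fun χ hχ Φ => A.thetaReal34 V c hc χ hχ Φ
    cover := fun Γ Γ' h => T.cover Γ Γ' h
    Λ_cover := ?_
    level_inf := hLD L ι₁ V
    inner_Λ := ?_ }⟩
  · -- Prop 4.3 on forms ⇒ on L² functions (Hodge–Riemann)
    obtain ⟨Γ, ω₁, h₁, ω₂, h₂, hne⟩ := A.thetaWedge V c hc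
    exact ⟨Γ, ω₁, h₁, ω₂, h₂,
      T.emb_ne_zero M A.innerEmb hHR Γ (cup2C_mem_F2 M _ (hH10 0 Γ ω₁ h₁) (hH10 1 Γ ω₂ h₂)) hne⟩
  · -- level independence of the wedge-function
    intro Γ Γ' h ω ω'
    show T.emb Γ' (U.cup2C _ 1 (U.pullC (T.cover Γ Γ' h) 1 ω) (U.pullC (T.cover Γ Γ' h) 1 ω')) =
      T.emb Γ (U.cup2C _ 1 ω ω')
    rw [← pullC_cup2C M.pull_cup]
    exact A.embCover Γ Γ' h _
  · -- Petersson = period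
    intro Γ
    obtain ⟨c₀, hc₀, h⟩ := A.innerEmb Γ
    refine ⟨c₀, hc₀, fun ω hω => ?_⟩
    show ⟪T.emb Γ (U.cup2C _ 1 (ω 2) (ω 3)), T.emb Γ (U.cup2C _ 1 (ω 0) (ω 1))⟫_ℂ = c₀ * U.period _ ω
    rw [h _ _ (cup2C_mem_F2 M _ (hω 0) (hω 1)) (cup2C_mem_F2 M _ (hω 2) (hω 3)), conj_cup2C _ 1]
    rfl

/-- **The construction** with `LevelDirected` (`HodgeCM.levelDirected`) AND `Lemma33bLandherr` discharged: in a
seesaw context satisfying PerL's hypotheses the theta realisation data exist (cf. `nonempty_thetaRealisation`,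
whose hypotheses `hLD`, `hL` are gone). -/
theorem nonempty_thetaRealisation'' (M : U.ModelAxioms) (A : T.Inputs) (hHR : U.Fact_hodgeRiemann20)
    {K L : CMField} (j : K →+* L) (ι₁ : L →+* ℂ)
    (Ψ : Fin 4 → CMType K) (σ : K →+* ℂ) (hσ : ι₁.comp j = σ) (hΨ : PairSum Ψ)
    (hinj : Function.Injective Ψ) (hmem : ∀ i, σ ∈ (Ψ i).1) (V : HermSpace3 L ι₁) :
    Nonempty (U.ThetaRealisation ι₁ V K Ψ σ) := by
  obtain ⟨D, hD⟩ := T.exists_seesawDatum_constructed A.kappaConj A.frameSignConj j ι₁ Ψ hΨ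
  exact T.nonempty_thetaRealisation_of_seesaw M A hHR levelDirected j ι₁ Ψ σ hσ hΨ hinj hmem V D hD

/-- **PerL setting**, `LevelDirected` and `Lemma33bLandherr` discharged (cf. `realisationExistsPerL_of`,
`realisationExistsPerL_of'`). -/
theorem realisationExistsPerL_of'' (M : U.ModelAxioms) (A : T.Inputs) (hHR : U.Fact_hodgeRiemann20) :
    U.RealisationExistsPerL := by
  intro K L j _ hK _ φ hφ ι₁ hι₁ t ht V
  have hmem : ∀ i, φ 0 ∈ (t i).1 := fun i => (ht i 0).mpr (by fin_cases i <;> rfl)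
  exact T.nonempty_thetaRealisation'' M A hHR j ι₁ t (φ 0) hι₁
    (StubTree.pairSum_of_isPerLTypes K φ hφ hK t ht) (StubTree.injective_of_isPerLTypes K φ hφ t ht) hmem V

/-- **Face setting**, `LevelDirected` and `Lemma33bLandherr` discharged (cf. `realisationExistsFace_of`,
`realisationExistsFace_of'`). -/
theorem realisationExistsFace_of'' (M : U.ModelAxioms) (A : T.Inputs) (hHR : U.Fact_hodgeRiemann20) :
    U.RealisationExistsFace := by
  intro F _ _ f ι₁ hadm V
  exact T.nonempty_thetaRealisation'' M A hHR (RingHom.id F) ι₁ f.psi ι₁ (RingHom.comp_id ι₁)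
    (pairSum_psi f) (StubTree.psi_injective F f) (admissible_mem_psi f ι₁ hadm) V

/-- Both realisation inputs of `U.OpenInputs` at once, from `M`, `T.Inputs` and `Fact_hodgeRiemann20` only. -/
theorem realisationExists_of'' (M : U.ModelAxioms) (A : T.Inputs) (hHR : U.Fact_hodgeRiemann20) :
    U.RealisationExistsPerL ∧ U.RealisationExistsFace :=
  ⟨T.realisationExistsPerL_of'' M A hHR, T.realisationExistsFace_of'' M A hHR⟩

end ThetaModel

end Universe

/-! ### Headline variants without `LevelDirected` and without `Lemma33bLandherr` -/

namespace Assembly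

variable (U : Universe)

/-- **PerL** from the model facts, the theta model and `Fact_hodgeRiemann20` (cf. `perL_theta`, `perL_theta'`:
`LevelDirected` and `Lemma33bLandherr` are no longer hypotheses). -/
theorem perL_theta'' (M : U.ModelAxioms) (T : U.ThetaModel) (A : T.Inputs) (hHR : U.Fact_hodgeRiemann20) :
    U.PerL :=
  perL U M (T.realisationExistsPerL_of'' M A hHR)

/-- **rfwf Thm 4.1** from the theta model and `Fact_hodgeRiemann20` (cf. `periodThmF_theta`). -/
theorem periodThmF_theta'' (M : U.ModelAxioms) (T : U.ThetaModel) (A : T.Inputs)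
    (hHR : U.Fact_hodgeRiemann20) : U.PeriodThmF :=
  periodThmF U M (T.realisationExistsFace_of'' M A hHR)

/-- **COR-CM** from the theta model (cf. `COR_CM_theta`, `COR_CM_theta'`): the remaining named inputs are
`T.Inputs`, `Fact_hodgeRiemann20`, `PohlmannSpan`, `Qw8Sufficiency`. -/
theorem COR_CM_theta'' (M : U.ModelAxioms) (T : U.ThetaModel) (A : T.Inputs) (hHR : U.Fact_hodgeRiemann20)
    (hP : U.PohlmannSpan) (hQ : U.Qw8Sufficiency) : U.HC_CM :=
  COR_CM U M (T.realisationExistsFace_of'' M A hHR) hP hQ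

/-- The record of open inputs of the theta-model route WITHOUT the `levelDirected` and `landherr` fields
(cf. `OpenInputsTheta`, `OpenInputsTheta'`). -/
structure OpenInputsTheta'' (T : U.ThetaModel) : Prop where
  /-- the ten named inputs of `HodgeCM.Automorphic.ThetaFacts` (`ThetaModel.Inputs`: 2 PRINT, 2 DESIGN,
  6 PerL OPEN INPUTS) -/
  theta : T.Inputs
  /-- Hodge–Riemann for holomorphic 2-forms on a surface (PRINT) -/
  hodgeRiemann20 : U.Fact_hodgeRiemann20
  /-- Pohlmann 1968 (unchanged) -/
  pohlmann_span : U.PohlmannSpan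
  /-- [QW8] Thm 2.5 + Milne 1999 (unchanged) -/
  qw8_sufficiency : U.Qw8Sufficiency

/-- The `'` record gives the `''` record (drop the Landherr field). -/
theorem openInputsTheta''_of (T : U.ThetaModel) (I : OpenInputsTheta' U T) : OpenInputsTheta'' U T :=
  ⟨I.theta, I.hodgeRiemann20, I.pohlmann_span, I.qw8_sufficiency⟩

/-- `U.OpenInputs` from the `''` record. -/
theorem openInputs_of_theta'' (M : U.ModelAxioms) (T : U.ThetaModel) (I : OpenInputsTheta'' U T) :
    U.OpenInputs where
  realisation_perL := T.realisationExistsPerL_of'' M I.theta I.hodgeRiemann20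
  realisation_face := T.realisationExistsFace_of'' M I.theta I.hodgeRiemann20
  pohlmann_span := I.pohlmann_span
  qw8_sufficiency := I.qw8_sufficiency

/-- **COR-CM from the `''` record** (open inputs: `T.Inputs`, `Fact_hodgeRiemann20`, `PohlmannSpan`,
`Qw8Sufficiency`). -/
theorem COR_CM_of_openInputsTheta'' (M : U.ModelAxioms) (T : U.ThetaModel) (I : OpenInputsTheta'' U T) :
    U.HC_CM :=
  COR_CM_of_openInputs U M (openInputs_of_theta'' U M T I)

end Assembly

end HodgeCM

end
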